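import Summits.AtomisticToContinuum.BoseEinsteinCondensation.Theorems.BECThomsonPrincipleFibreConductanceStubTwoScaleSplitHelpers
import HarnessLib

/-!
# Route `BECThomsonPrinciple`, crux `FibreConductance` (stmt-AtomisticToContinuum-9480),
# line `conditional-law-poincare` — stub `stub_localChargeSq`: the local charge is small in `L²`

On every cube `Q = cubeSet L ν Q` (side `ℓ = side L ν`) of every `x₀`-fibre of a zero-free state,
the fibre charge `q = L^{-3/2}(e^{ik·y}ψ − βψ²)` minus its `ψ²`-weighted cube part
`q_c = ψ²·c_Q/μ_Q` (`c_Q = ∫_Q q`, `μ_Q = ∫_Q ψ²`) satisfies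
`∫_Q |q − q_c|² ≤ (2/L³)(μ_Q + ℓ³·∫_Qψ⁴/μ_Q)`.

Proof: `β`, `c_Q`, `μ_Q` are constant along the fibre (`fibreBeta_update`), so
`c_Q = L^{-3/2}(A_Q − βμ_Q)` with `A_Q = ∫_Q e^{ik·z}ψ`, and `β` cancels exactly:
`q − q_c = L^{-3/2}(e^{ik·y}ψ − ψ²A_Q/μ_Q)`; then `|a − b|² ≤ 2|a|² + 2|b|²`, `|e^{ik·y}| = 1`,
`|L^{-3/2}|² = 1/L³` and Cauchy–Schwarz against `1` on the cube, `|A_Q|² ≤ (∫_Q ψ)² ≤ |Q|·μ_Q`,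
`|Q| = ℓ³` (`volume_cubeSet`). The registered signature is `localChargeSq_le` (the lead wires
`stub_localChargeSq := localChargeSq_le`). All [folklore].
-/

noncomputable section

namespace Summit.AtomisticToContinuum.BoseEinsteinCondensation.Cruxes.FibreConductance.ConditionalLawPoincare

open MeasureTheory Set
open scoped ENNReal
open Literature.MathematicalPhysics.QuantumManyBody.BoseGas
open Summit.AtomisticToContinuum.BoseEinsteinCondensation.Cruxes.FibreConductance.ParsevalShellBootstrap
open Summit.AtomisticToContinuum.BoseEinsteinCondensation.Cruxes.FibreConductance.HealingSplitKineticDefect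

variable {m : ℕ} {L : ℝ}

/-! ### The volume of a cube of the tiling -/

/-- `|Q| = ℓ³` (as `ofReal ℓ ^ 3`). [folklore] -/
theorem volume_cubeSet (L : ℝ) (ν : ℕ) (Q : Fin 3 → Fin (ν + 1)) :
    volume (cubeSet L ν Q) = ENNReal.ofReal (side L ν) ^ 3 := by
  -- adapted from `volume_cell` (PeriodicBoseGas.lean)
  have h : cubeSet L ν Q = (@WithLp.ofLp 2 (Fin 3 → ℝ)) ⁻¹' (Set.univ.pi fun l : Fin 3 =>
      Ico (((Q l : ℕ) : ℝ) * side L ν) ((((Q l : ℕ) : ℝ) + 1) * side L ν)) := by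
    ext x; simp [cubeSet]
  rw [h, (PiLp.volume_preserving_ofLp (Fin 3)).measure_preimage
    (MeasurableSet.univ_pi fun _ => measurableSet_Ico).nullMeasurableSet, volume_pi_pi]
  have e : ∀ l : Fin 3,
      (((Q l : ℕ) : ℝ) + 1) * side L ν - ((Q l : ℕ) : ℝ) * side L ν = side L ν := fun l => by ring
  simp only [Real.volume_Ico, e, Finset.prod_const, Finset.card_univ, Fintype.card_fin]

/-- `|Q| = ℓ³` in real form (`L > 0`). [folklore] -/
theorem volume_real_cubeSet (hL : 0 < L) (ν : ℕ) (Q : Fin 3 → Fin (ν + 1)) :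
    (volume : Measure Space).real (cubeSet L ν Q) = side L ν ^ 3 := by
  rw [measureReal_def, volume_cubeSet, ← ENNReal.ofReal_pow (side_pos hL ν).le,
    ENNReal.toReal_ofReal (pow_nonneg (side_pos hL ν).le 3)]

/-! ### Cauchy–Schwarz against `1` (discriminant form) -/

/-- `(∫_S f)² ≤ |S| · ∫_S f²` on a measurable set of finite positive measure, for `f`, `f²`
integrable on `S` (nonnegativity of `∫_S (|S| f − ∫_S f)²`). [folklore] -/
theorem sq_setIntegral_le_measureReal_mul {S : Set Space} (hS : MeasurableSet S)
    (hV : 0 < (volume : Measure Space).real S) {f : Space → ℝ} (hf : IntegrableOn f S)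
    (hf2 : IntegrableOn (fun y => f y ^ 2) S) :
    (∫ y in S, f y) ^ 2 ≤ (volume : Measure Space).real S * ∫ y in S, f y ^ 2 := by
  have hlt : volume S < ∞ := (ENNReal.toReal_pos_iff.1 hV).2
  haveI : IsFiniteMeasure (volume.restrict S) := isFiniteMeasure_restrict.2 hlt.ne
  -- `0 ≤ ∫_S (V f − a)² = V²∫f² − 2Va∫f + |S|a²` for all real `V`, `a`
  have key : ∀ V a : ℝ, 0 ≤ V ^ 2 * (∫ y in S, f y ^ 2) - 2 * V * a * (∫ y in S, f y) +
      (volume : Measure Space).real S * a ^ 2 := by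
    intro V a
    have i1 : Integrable (fun y => V ^ 2 * f y ^ 2) (volume.restrict S) := hf2.const_mul _
    have i2 : Integrable (fun y => 2 * V * a * f y) (volume.restrict S) := hf.const_mul _
    have i3 : Integrable (fun y => V ^ 2 * f y ^ 2 - 2 * V * a * f y) (volume.restrict S) :=
      i1.sub i2
    have i4 : Integrable (fun _ : Space => a ^ 2) (volume.restrict S) := integrable_const _
    have h0 : 0 ≤ ∫ y in S, (V * f y - a) ^ 2 := setIntegral_nonneg hS fun _ _ => sq_nonneg _
    have e : ∀ y, (V * f y - a) ^ 2 = (V ^ 2 * f y ^ 2 - 2 * V * a * f y) + a ^ 2 := fun y => by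
      ring
    simp_rw [e] at h0
    rwa [integral_add i3 i4, integral_sub i1 i2, integral_const_mul, integral_const_mul,
      setIntegral_const, smul_eq_mul] at h0
  have h := key ((volume : Measure Space).real S) (∫ y in S, f y)
  nlinarith [h, hV]

/-! ### The pointwise algebra: `β` cancels -/

/-- With `c_Q = c(A − βμ)`: `c(eψ − βψ²) − ψ²c_Q/μ = c(eψ − ψ²A/μ)`, whence
`|c(eψ − βψ²) − ψ²c_Q/μ|² ≤ 2|c|²(ψ² + ψ⁴|A|²/μ²)` for `|e| = 1`, `μ ≠ 0`. [folklore] -/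
theorem norm_sq_local_le (c e A β : ℂ) (ψ μ : ℝ) (hμ : μ ≠ 0) (he : ‖e‖ = 1) :
    ‖c * (e * (ψ : ℂ) - β * (ψ : ℂ) ^ 2) -
        ((ψ ^ 2 : ℝ) : ℂ) * (c * (A - β * (μ : ℂ)) / (μ : ℂ))‖ ^ 2 ≤
      2 * ‖c‖ ^ 2 * (ψ ^ 2 + ψ ^ 4 * (‖A‖ ^ 2 / μ ^ 2)) := by
  have hμ' : (μ : ℂ) ≠ 0 := Complex.ofReal_ne_zero.2 hμ
  have hid : c * (e * (ψ : ℂ) - β * (ψ : ℂ) ^ 2) -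
        ((ψ ^ 2 : ℝ) : ℂ) * (c * (A - β * (μ : ℂ)) / (μ : ℂ)) =
      c * (e * (ψ : ℂ) - (ψ : ℂ) ^ 2 * A / (μ : ℂ)) := by
    push_cast
    field_simp
    ring
  rw [hid, norm_mul, mul_pow]
  have h1 : ‖e * (ψ : ℂ) - (ψ : ℂ) ^ 2 * A / (μ : ℂ)‖ ≤ |ψ| + ψ ^ 2 * ‖A‖ / |μ| := by
    refine (norm_sub_le _ _).trans (le_of_eq ?_)
    rw [norm_mul, he, one_mul, Complex.norm_real, Real.norm_eq_abs, norm_div, norm_mul, norm_pow,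
      Complex.norm_real, Complex.norm_real, Real.norm_eq_abs, Real.norm_eq_abs, sq_abs]
  have h2 : ‖e * (ψ : ℂ) - (ψ : ℂ) ^ 2 * A / (μ : ℂ)‖ ^ 2 ≤
      2 * (ψ ^ 2 + ψ ^ 4 * (‖A‖ ^ 2 / μ ^ 2)) := by
    calc ‖e * (ψ : ℂ) - (ψ : ℂ) ^ 2 * A / (μ : ℂ)‖ ^ 2 ≤ (|ψ| + ψ ^ 2 * ‖A‖ / |μ|) ^ 2 :=
          pow_le_pow_left₀ (norm_nonneg _) h1 2
      _ ≤ 2 * |ψ| ^ 2 + 2 * (ψ ^ 2 * ‖A‖ / |μ|) ^ 2 := by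
          nlinarith [sq_nonneg (|ψ| - ψ ^ 2 * ‖A‖ / |μ|)]
      _ = 2 * (ψ ^ 2 + ψ ^ 4 * (‖A‖ ^ 2 / μ ^ 2)) := by
          rw [sq_abs, div_pow, mul_pow, sq_abs]; ring
  calc ‖c‖ ^ 2 * ‖e * (ψ : ℂ) - (ψ : ℂ) ^ 2 * A / (μ : ℂ)‖ ^ 2
      ≤ ‖c‖ ^ 2 * (2 * (ψ ^ 2 + ψ ^ 4 * (‖A‖ ^ 2 / μ ^ 2))) :=
        mul_le_mul_of_nonneg_left h2 (sq_nonneg _)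
    _ = 2 * ‖c‖ ^ 2 * (ψ ^ 2 + ψ ^ 4 * (‖A‖ ^ 2 / μ ^ 2)) := by ring

/-! ### The analytic core on an abstract fibre -/

/-- The local charge bound for an abstract continuous positive amplitude `ψ` on the fibre, a
unimodular continuous phase `e` and constants `c`, `β`:
`∫_Q |c(eψ − βψ²) − ψ²c_Q/μ_Q|² ≤ 2|c|²(μ_Q + ℓ³∫_Qψ⁴/μ_Q)`. [folklore] -/
theorem integral_norm_sq_local_le (hL : 0 < L) {ν : ℕ} (Q : Fin 3 → Fin (ν + 1))
    {ψ : Space → ℝ} (hψc : Continuous ψ) (hψpos : ∀ y, 0 < ψ y)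
    {e : Space → ℂ} (hec : Continuous e) (he1 : ∀ y, ‖e y‖ = 1) (c β : ℂ) :
    ∫ y in cubeSet L ν Q, ‖c * (e y * (ψ y : ℂ) - β * (ψ y : ℂ) ^ 2) -
        ((ψ y ^ 2 : ℝ) : ℂ) * ((∫ z in cubeSet L ν Q, c * (e z * (ψ z : ℂ) - β * (ψ z : ℂ) ^ 2)) /
          ((∫ z in cubeSet L ν Q, ψ z ^ 2 : ℝ) : ℂ))‖ ^ 2 ≤
      2 * ‖c‖ ^ 2 * ((∫ z in cubeSet L ν Q, ψ z ^ 2) +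
        side L ν ^ 3 * (∫ z in cubeSet L ν Q, ψ z ^ 4) / (∫ z in cubeSet L ν Q, ψ z ^ 2)) := by
  set S := cubeSet L ν Q with hS_def
  have hS : MeasurableSet S := measurableSet_cubeSet L ν Q
  set μ : ℝ := ∫ z in S, ψ z ^ 2 with hμ_def
  set M4 : ℝ := ∫ z in S, ψ z ^ 4 with hM4_def
  set A : ℂ := ∫ z in S, e z * (ψ z : ℂ) with hA_def
  have hψC : Continuous fun y => (ψ y : ℂ) := Complex.continuous_ofReal.comp hψc
  -- `μ_Q > 0`, `∫_Q ψ⁴ ≥ 0`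
  have hμpos : 0 < μ := by
    have i2 : IntegrableOn (fun z => ψ z ^ 2) S := integrableOn_cubeSet hL Q (by fun_prop)
    rw [hμ_def, integral_pos_iff_support_of_nonneg_ae
      (Filter.Eventually.of_forall fun z => sq_nonneg (ψ z)) i2]
    have hsupp : Function.support (fun z : Space => ψ z ^ 2) = Set.univ :=
      Set.eq_univ_of_forall fun z => (pow_pos (hψpos z) 2).ne'
    rw [hsupp, Measure.restrict_apply_univ, volume_cubeSet]
    exact ENNReal.pow_pos (ENNReal.ofReal_pos.2 (side_pos hL ν)) 3
  have hμne : μ ≠ 0 := hμpos.ne'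
  have hM4 : 0 ≤ M4 := setIntegral_nonneg hS fun z _ => by positivity
  -- the cube charge: `c_Q = c (A − β μ)`
  have hcQ : ∫ z in S, c * (e z * (ψ z : ℂ) - β * (ψ z : ℂ) ^ 2) = c * (A - β * (μ : ℂ)) := by
    have h1 : IntegrableOn (fun z => e z * (ψ z : ℂ)) S := integrableOn_cubeSet hL Q (hec.mul hψC)
    have h2 : IntegrableOn (fun z => β * (ψ z : ℂ) ^ 2) S :=
      integrableOn_cubeSet hL Q (continuous_const.mul (hψC.pow 2))
    rw [integral_const_mul, integral_sub h1 h2, integral_const_mul]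
    congr 3
    simp_rw [← Complex.ofReal_pow]
    exact integral_ofReal
  rw [hcQ]
  -- Cauchy–Schwarz: `|A|² ≤ ℓ³ μ`
  have hA : ‖A‖ ^ 2 ≤ side L ν ^ 3 * μ := by
    have h1 : ‖A‖ ≤ ∫ z in S, ψ z := by
      refine (norm_integral_le_integral_norm _).trans (le_of_eq ?_)
      refine integral_congr_ae (Filter.Eventually.of_forall fun z => ?_)
      simp only [norm_mul, he1, one_mul, Complex.norm_real, Real.norm_eq_abs, abs_of_pos (hψpos z)]
    have i2 : IntegrableOn (fun z => ψ z ^ 2) S := integrableOn_cubeSet hL Q (by fun_prop)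
    have h2 := sq_setIntegral_le_measureReal_mul hS
      (by rw [volume_real_cubeSet hL]; exact pow_pos (side_pos hL ν) 3)
      (integrableOn_cubeSet hL Q hψc) i2
    rw [volume_real_cubeSet hL] at h2
    exact (pow_le_pow_left₀ (norm_nonneg _) h1 2).trans h2
  -- pointwise bound, integrated
  have hK : Continuous fun y => 2 * ‖c‖ ^ 2 * (ψ y ^ 2 + ψ y ^ 4 * (‖A‖ ^ 2 / μ ^ 2)) := by
    fun_prop
  calc ∫ y in S, ‖c * (e y * (ψ y : ℂ) - β * (ψ y : ℂ) ^ 2) -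
          ((ψ y ^ 2 : ℝ) : ℂ) * (c * (A - β * (μ : ℂ)) / (μ : ℂ))‖ ^ 2
      ≤ ∫ y in S, 2 * ‖c‖ ^ 2 * (ψ y ^ 2 + ψ y ^ 4 * (‖A‖ ^ 2 / μ ^ 2)) :=
        integral_mono_of_nonneg (Filter.Eventually.of_forall fun y => sq_nonneg _)
          (integrableOn_cubeSet hL Q hK)
          (Filter.Eventually.of_forall fun y =>
            norm_sq_local_le c (e y) A β (ψ y) μ hμne (he1 y))
    _ = 2 * ‖c‖ ^ 2 * (μ + M4 * (‖A‖ ^ 2 / μ ^ 2)) := by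
        have i2 : IntegrableOn (fun y => ψ y ^ 2) S := integrableOn_cubeSet hL Q (by fun_prop)
        have i4 : IntegrableOn (fun y => ψ y ^ 4 * (‖A‖ ^ 2 / μ ^ 2)) S :=
          integrableOn_cubeSet hL Q (by fun_prop)
        rw [integral_const_mul, integral_add i2 i4, integral_mul_const]
    _ ≤ 2 * ‖c‖ ^ 2 * (μ + side L ν ^ 3 * M4 / μ) := by
        have h : M4 * (‖A‖ ^ 2 / μ ^ 2) ≤ side L ν ^ 3 * M4 / μ := by
          calc M4 * (‖A‖ ^ 2 / μ ^ 2) ≤ M4 * (side L ν ^ 3 * μ / μ ^ 2) :=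
                mul_le_mul_of_nonneg_left (div_le_div_of_nonneg_right hA (sq_nonneg μ)) hM4
            _ = side L ν ^ 3 * M4 / μ := by
                rw [pow_two, mul_div_mul_right _ _ hμne, mul_div_assoc', mul_comm M4]
        exact mul_le_mul_of_nonneg_left (add_le_add le_rfl h) (by positivity)

/-! ### The registered signature -/

/-- **`stub_localChargeSq` (helper name `localChargeSq_le`) — the local charge is small in `L²`.**
For every zero-free state, block count `ν`, mode `n`, cube `Q` and fibre:
`∫_Q |q − ψ²·(∫_Q q)/(∫_Q ψ²)|² dy ≤ (2/L³)(μ_Q + ℓ³(∫_Qψ⁴)/μ_Q)`, `μ_Q = ∫_Qψ²`,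
`q = L^{-3/2}(e^{ik·y}ψ − βψ²)`. By `integral_norm_sq_local_le` with `ψ(y) = ψ(X[0↦y])`,
`e = phase L n` (`update_self`), the fibre constant `β = β(X)` (`fibreBeta_update`) and
`|L^{-3/2}|² = L⁻³`. [folklore] -/
theorem localChargeSq_le :
  ∀ (m : ℕ) (L : ℝ), 0 < L → ∀ (ν : ℕ) (n : Fin 3 → ℤ) (Φ : PeriodicTrialState (m + 1) L),
    (∀ X, Φ.ψ X ≠ 0) → ∀ (Q : Fin 3 → Fin (ν + 1)) (X : Config (m + 1)),
      ∫ y in cubeSet L ν Q, ‖((Real.sqrt (L ^ 3))⁻¹ : ℂ) *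
            (phase L n (Function.update X 0 y 0) * (fibrePsi Φ (Function.update X 0 y) : ℂ) -
              fibreBeta n Φ (Function.update X 0 y) * (fibrePsi Φ (Function.update X 0 y) : ℂ) ^ 2) -
          ((fibrePsi Φ (Function.update X 0 y) ^ 2 : ℝ) : ℂ) *
            ((∫ z in cubeSet L ν Q, ((Real.sqrt (L ^ 3))⁻¹ : ℂ) *
                (phase L n (Function.update X 0 z 0) * (fibrePsi Φ (Function.update X 0 z) : ℂ) -
                  fibreBeta n Φ (Function.update X 0 z) *
                    (fibrePsi Φ (Function.update X 0 z) : ℂ) ^ 2)) /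
              ((∫ z in cubeSet L ν Q, fibrePsi Φ (Function.update X 0 z) ^ 2 : ℝ) : ℂ))‖ ^ 2 ≤
        2 / L ^ 3 * ((∫ z in cubeSet L ν Q, fibrePsi Φ (Function.update X 0 z) ^ 2) +
          side L ν ^ 3 * (∫ z in cubeSet L ν Q, fibrePsi Φ (Function.update X 0 z) ^ 4) /
            (∫ z in cubeSet L ν Q, fibrePsi Φ (Function.update X 0 z) ^ 2)) := by
  intro m L hL ν n Φ hΦ Q X
  have hψc : Continuous fun y : Space => fibrePsi Φ (Function.update X 0 y) :=
    (continuous_fibrePsi hL Φ hΦ).comp (continuous_const.update 0 continuous_id)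
  have hc2 : 2 * ‖((Real.sqrt (L ^ 3))⁻¹ : ℂ)‖ ^ 2 = 2 / L ^ 3 := by
    have hL3 : 0 < L ^ 3 := by positivity
    rw [norm_inv, Complex.norm_real, Real.norm_of_nonneg (Real.sqrt_nonneg _), inv_pow,
      Real.sq_sqrt hL3.le, div_eq_mul_inv]
  have h := integral_norm_sq_local_le hL Q hψc (fun y => fibrePsi_pos hL Φ hΦ _)
    ((contDiff_phase L n (k := 0)).continuous) (norm_phase L n) ((Real.sqrt (L ^ 3))⁻¹ : ℂ)
    (fibreBeta n Φ X)
  rw [hc2] at h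
  simp only [Function.update_self, fibreBeta_update]
  exact h

end Summit.AtomisticToContinuum.BoseEinsteinCondensation.Cruxes.FibreConductance.ConditionalLawPoincare

end
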